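import Literature.AlgebraicGeometry.Resolution.HilbertSamuelMaxValuesNonincrease
import Literature.AlgebraicGeometry.Resolution.HilbertSamuelIsolatedSingularities
import HarnessLib

/-!
# The first blow-up `X₁ = Bℓ_{X_max}(X) → X` of the CJS strategy for a normal surface does not
# increase the Hilbert–Samuel function (CJS 2020, Thm. 3.10 (1) and Cor. 3.12 in Rem. 6.29)

Topic: `Literature/AlgebraicGeometry/Resolution`. Cossart–Jannsen–Saito, LNM 2270, Rem. 6.29 /
proof of Thm. 6.28, Step 1 (`dim X(ν̃) = 0`): "blow up `X(ν̃)`", followed by Thm. 3.10 (1)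
("`H_{X'}(x') ≤ H_X(x)`") and Cor. 3.12 ("for `ν ∈ Σ_X^max`, either `ν ∉ Σ_{X'}` or
`ν ∈ Σ_{X'}^max` …") for this permissible blow-up. `HilbertSamuelIsolatedSingularities.lean`
constructs the first blow-up of a normal surface over a field (with `N = 2 = dim X`);
`PointBlowupHsFunMono.lean` proves Thm. 3.10 (1) for the blow-up of a finite set of closed points
in the Bennett–Hironaka form, i.e. for `N > ψ_X` on the centre. This file ASSEMBLES the two for
`N ≥ dim X + 1` (so `N = 3` for surfaces; every fixed `N ≥ dim X` is admissible in Def. 2.28, and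
`ψ_X ≤ dim X < N` everywhere):

* `Scheme.hsPsi_lt_of_topologicalKrullDim_lt` — `ψ_X(x) ≤ dim 𝒪_{X,x} ≤ dim X < N`;
* `hmono_blowup_hsMaxLocus_of_normal_surface` — **`H^N_{X₁}(x') ≤ H^N_X(π x')` for every point
  `x'` of `X₁ = Bℓ_{X_max}(X)`**, `X` a non-regular normal surface of finite type over a field,
  `N ≥ 3` (the hypothesis `hmono` of `Scheme.no_infinite_hsFun_tower` for the first step);
* `cor_3_12_blowup_hsMaxLocus_of_normal_surface` — Cor. 3.12 for this blow-up;
* `hsMaxLocus_of_normal_surface'`, `firstBlowup_of_normal_surface'` — the `N`-indexed versions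
  (`N ≥ 2`) of the `N = 2` statements of `HilbertSamuelIsolatedSingularities.lean`;
* `NormalSurface.firstBlowup_hmono` — bundled form for `NormalSurface k` (`LipmanProcedure.lean`).

No definitions and no named facts are introduced.

## Sources

* V. Cossart, U. Jannsen, S. Saito, LNM 2270 (2020), Rem. 6.29, Thm. 6.28 (proof, Step 1),
  Thm. 3.10 (1), Cor. 3.12, Def. 2.28. [CossartJannsenSaito2020]
-/

noncomputable section

open CategoryTheory AlgebraicGeometry TopologicalSpace IsLocalRing
open AlgebraicGeometry.Scheme.IdealSheafData
open Literature.RingTheory.HilbertSamuel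

namespace Literature.AlgebraicGeometry.Resolution

universe u

variable {X : Scheme.{u}}

/-- **`ψ_X(x) < N` whenever `dim X < N`** (`ψ_X(x) ≤ dim 𝒪_{X,x} ≤ dim X`; CJS Def. 2.28 fixes
`N ≥ dim X`). [cite: CossartJannsenSaito2020, Def. 2.28] -/
theorem Scheme.hsPsi_lt_of_topologicalKrullDim_lt [IsIntegral X] [IsLocallyNoetherian X] {N : ℕ}
    (hdim : topologicalKrullDim X < N) (x : X) : Scheme.hsPsi X x < N := by
  obtain ⟨d, hd⟩ : ∃ d : ℕ, ringKrullDim (X.presheaf.stalk x) = d :=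
    exists_nat_eq_of_ne_bot_of_ne_top ringKrullDim_ne_bot ringKrullDim_ne_top
  rw [Scheme.hsPsi_eq_of_isDomain hd]
  have hle := ringKrullDim_stalk_le_topologicalKrullDim X x
  rw [hd] at hle
  have : ((d : ℕ) : WithBot ℕ∞) < (N : ℕ) := hle.trans_lt (by exact_mod_cast hdim)
  exact_mod_cast this

/-- `dim 𝒪_{X,x} ≤ 2 ≤ N` at every point of a surface. [cite: CossartJannsenSaito2020, Def. 2.28] -/
theorem exists_ringKrullDim_stalk_eq_of_surface [IsLocallyNoetherian X]
    (hdim : topologicalKrullDim X ≤ 2) {N : ℕ} (hN2 : 2 ≤ N) (x : X) :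
    ∃ d : ℕ, ringKrullDim (X.presheaf.stalk x) = d ∧ d ≤ N := by
  obtain ⟨d, hd, hd2⟩ := exists_ringKrullDim_stalk_eq_of_topologicalKrullDim_le (X := X) hdim x
  exact ⟨d, hd, hd2.trans hN2⟩

section NormalSurfaces

variable {k : Type u} [Field k] [IsIntegral X] [_root_.AlgebraicGeometry.IsNoetherian X]
  (f : X ⟶ Spec (.of k)) [LocallyOfFiniteType f]
  (hN : ∀ x : X, IsIntegrallyClosed (X.presheaf.stalk x))
  (hdim : topologicalKrullDim X ≤ 2) {N : ℕ} (hN2 : 2 ≤ N)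

include f hN hdim hN2 in
/-- **The Hilbert–Samuel locus (for any `N ≥ 2`) of a non-regular normal surface over a field is a
finite, non-empty set of closed singular points** (`N`-indexed form of
`Scheme.hsMaxLocus_of_normal_surface`). [cite: CossartJannsenSaito2020, Rem. 6.29] -/
theorem hsMaxLocus_of_normal_surface' (hX : ¬Scheme.IsRegular X) :
    (Scheme.hsMaxLocus X N).Finite ∧ (Scheme.hsMaxLocus X N).Nonempty ∧
      Scheme.hsMaxLocus X N ⊆ (Scheme.regularLocus X)ᶜ ∧
        ∀ x ∈ Scheme.hsMaxLocus X N, IsClosed ({x} : Set X) := by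
  have hd := exists_ringKrullDim_stalk_eq_of_surface (X := X) hdim hN2
  have hS := finite_compl_regularLocus_of_normal_surface f hN hdim
  have hcl : ∀ x ∈ (Scheme.regularLocus X)ᶜ, IsClosed ({x} : Set X) := fun _ hx =>
    isClosed_singleton_of_not_mem_regularLocus hN hdim hx
  obtain ⟨hfin, hsub, hclm⟩ := Scheme.hsMaxLocus_finite_of_finite_compl_regularLocus hd hX hS hcl
  exact ⟨hfin, Scheme.hsMaxLocus_nonempty_of_finite
    (Scheme.hsValues_finite_of_finite_compl_regularLocus hd hS), hsub, hclm⟩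

include f hN hdim hN2 in
/-- **The first blow-up of the CJS strategy, `N`-indexed form (`N ≥ 2`)**: with `Z = X_max`,
`Z` reduced is a permissible centre, `Bℓ_Z(X) → X` is a permissible blow-up, `Bℓ_Z(X)` is integral,
the blow-up is proper, birational, and an isomorphism over `Reg X`.
[cite: CossartJannsenSaito2020, Rem. 6.29] -/
theorem firstBlowup_of_normal_surface' (hX : ¬Scheme.IsRegular X) {Z : Closeds X}
    (hZ : (Z : Set X) = Scheme.hsMaxLocus X N) :
    IdealSheafData.IsPermissible (vanishingIdeal Z) ∧
      IsPermissibleBlowup (blowup.π (vanishingIdeal Z)) ∧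
        IsIntegral (blowup (vanishingIdeal Z)) ∧ IsProper (blowup.π (vanishingIdeal Z)) ∧
          IsBirational (blowup.π (vanishingIdeal Z)) ∧
            IsIso (blowup.π (vanishingIdeal Z) ∣_
              ⟨Scheme.regularLocus X, isOpen_regularLocus_of_locallyOfFiniteType_field f⟩) := by
  have hd := exists_ringKrullDim_stalk_eq_of_surface (X := X) hdim hN2
  have hS := finite_compl_regularLocus_of_normal_surface f hN hdim
  have hcl : ∀ x ∈ (Scheme.regularLocus X)ᶜ, IsClosed ({x} : Set X) := fun _ hx =>
    isClosed_singleton_of_not_mem_regularLocus hN hdim hx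
  refine ⟨isPermissible_vanishingIdeal_hsMaxLocus hd hX hS hcl hZ,
    isPermissibleBlowup_blowup_hsMaxLocus hd hX hS hcl hZ, isIntegral_blowup_hsMaxLocus hd hX hZ,
    isProper_blowup_hsMaxLocus Z, isBirational_blowup_hsMaxLocus hd hX hZ, ?_⟩
  refine (blowup.isBlowup _).isIso_morphismRestrict ?_
  rw [Set.disjoint_iff_inter_eq_empty, ← Set.subset_empty_iff]
  rintro x ⟨hxreg, hxZ⟩
  have hxZ' : x ∈ (Z : Set X) := by
    rw [← coe_support_vanishingIdeal Z]
    exact hxZ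
  rw [hZ] at hxZ'
  exact Scheme.hsMaxLocus_subset_compl_regularLocus hd hX hxZ' hxreg

include f hN hdim in
/-- **CJS Thm. 3.10 (1) for the first blow-up of a normal surface: `H^N_{X₁}(x') ≤ H^N_X(π x')` at
every point `x'` of `X₁ = Bℓ_{X_max}(X)`**, for `X` a non-regular normal (integral, integrally
closed local rings) surface of finite type over a field and any `N ≥ 3` (`X_max` is a finite set of
closed points and `ψ_X ≤ 2 < N`, so `IsBlowup.hsFun_le_of_finite_closedPoints_centre_of_locallyOfFiniteType`
applies). This is the hypothesis `hmono` of `Scheme.no_infinite_hsFun_tower` for the first step of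
the CJS strategy in dimension two. [cite: CossartJannsenSaito2020, Thm. 3.10 (1), Rem. 6.29] -/
theorem hmono_blowup_hsMaxLocus_of_normal_surface (hN3 : 3 ≤ N) (hX : ¬Scheme.IsRegular X)
    {Z : Closeds X} (hZ : (Z : Set X) = Scheme.hsMaxLocus X N) (x' : blowup (vanishingIdeal Z)) :
    Scheme.hsFun (blowup (vanishingIdeal Z)) N x' ≤
      Scheme.hsFun X N ((blowup.π (vanishingIdeal Z)).base x') := by
  obtain ⟨hfin, -, -, hclm⟩ := hsMaxLocus_of_normal_surface' f hN hdim (le_trans (by norm_num) hN3) hX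
  have hlt : topologicalKrullDim X < N :=
    hdim.trans_lt (by exact_mod_cast (show (2 : ℕ) < N by omega))
  exact (blowup.isBlowup (vanishingIdeal Z)).hsFun_le_of_finite_closedPoints_centre_of_locallyOfFiniteType
    f (hZ ▸ hfin) (fun y hy => hclm y (hZ ▸ hy)) Z.isClosed N
    (fun y _ => Scheme.hsPsi_lt_of_topologicalKrullDim_lt hlt y) x'

include f hN hdim in
/-- **CJS Cor. 3.12 for the first blow-up `π : X₁ = Bℓ_{X_max}(X) → X` of a normal surface**
(`N ≥ 3`): a maximal value of `Σ_X` surviving in `Σ_{X₁}` is maximal in `Σ_{X₁}`;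
`X₁(ν) ⊆ π⁻¹(X(ν))` for `ν ∈ Σ_X^max`; `π⁻¹(X(ν)) ⊆ ⋃_{μ ≤ ν} X₁(μ)`.
[cite: CossartJannsenSaito2020, Cor. 3.12, Rem. 6.29] -/
theorem cor_3_12_blowup_hsMaxLocus_of_normal_surface (hN3 : 3 ≤ N) (hX : ¬Scheme.IsRegular X)
    {Z : Closeds X} (hZ : (Z : Set X) = Scheme.hsMaxLocus X N) :
    (∀ ν, Maximal (· ∈ Scheme.hsValues X N) ν →
        ν ∈ Scheme.hsValues (blowup (vanishingIdeal Z)) N →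
          Maximal (· ∈ Scheme.hsValues (blowup (vanishingIdeal Z)) N) ν) ∧
      (∀ ν, Maximal (· ∈ Scheme.hsValues X N) ν →
        Scheme.hsStratum (blowup (vanishingIdeal Z)) N ν ⊆
          (blowup.π (vanishingIdeal Z)).base ⁻¹' Scheme.hsStratum X N ν) ∧
      (∀ ν : ℕ → ℕ, (blowup.π (vanishingIdeal Z)).base ⁻¹' Scheme.hsStratum X N ν ⊆
        ⋃ μ ∈ {μ : ℕ → ℕ | μ ≤ ν}, Scheme.hsStratum (blowup (vanishingIdeal Z)) N μ) := by
  have hmono := hmono_blowup_hsMaxLocus_of_normal_surface f hN hdim hN3 hX hZ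
  exact ⟨fun _ hν hν' => Scheme.maximal_hsValues_of_hmono N _ hmono hν hν',
    fun _ hν => Scheme.hsStratum_subset_preimage_of_hmono N _ hmono hν,
    fun ν => Scheme.preimage_hsStratum_subset_of_hmono N _ hmono ν⟩

end NormalSurfaces

/-! ## Bundled normal surfaces -/

namespace NormalSurface

variable {k : Type u} [Field k] (S : NormalSurface k)

/-- **The first blow-up of a non-regular bundled normal surface does not increase `H^3`** and
satisfies Cor. 3.12 (`N = 3 = dim X + 1`). [cite: CossartJannsenSaito2020, Thm. 3.10 (1), Cor. 3.12, Rem. 6.29] -/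
theorem firstBlowup_hmono (hX : ¬Scheme.IsRegular S.X) {Z : Closeds S.X}
    (hZ : (Z : Set S.X) = Scheme.hsMaxLocus S.X 3) :
    (∀ x' : blowup (vanishingIdeal Z), Scheme.hsFun (blowup (vanishingIdeal Z)) 3 x' ≤
        Scheme.hsFun S.X 3 ((blowup.π (vanishingIdeal Z)).base x')) ∧
      (∀ ν, Maximal (· ∈ Scheme.hsValues S.X 3) ν →
        ν ∈ Scheme.hsValues (blowup (vanishingIdeal Z)) 3 →
          Maximal (· ∈ Scheme.hsValues (blowup (vanishingIdeal Z)) 3) ν) ∧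
      (∀ ν, Maximal (· ∈ Scheme.hsValues S.X 3) ν →
        Scheme.hsStratum (blowup (vanishingIdeal Z)) 3 ν ⊆
          (blowup.π (vanishingIdeal Z)).base ⁻¹' Scheme.hsStratum S.X 3 ν) := by
  haveI := S.isNoetherian_X
  have h := cor_3_12_blowup_hsMaxLocus_of_normal_surface S.hom S.normal S.dim_eq.le le_rfl hX hZ
  exact ⟨hmono_blowup_hsMaxLocus_of_normal_surface S.hom S.normal S.dim_eq.le le_rfl hX hZ,
    h.1, h.2.1⟩

/-- **The first blow-up data of a non-regular bundled normal surface for `N = 3`**: `X_max` is a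
finite non-empty set of closed singular points, a permissible centre; `Bℓ_{X_max}(X) → X` is a
permissible, proper, birational blow-up from an integral scheme, an isomorphism over `Reg X`.
[cite: CossartJannsenSaito2020, Rem. 6.29] -/
theorem firstBlowup' (hX : ¬Scheme.IsRegular S.X) {Z : Closeds S.X}
    (hZ : (Z : Set S.X) = Scheme.hsMaxLocus S.X 3) :
    (Z : Set S.X).Finite ∧ (Z : Set S.X).Nonempty ∧ (Z : Set S.X) ⊆ (Scheme.regularLocus S.X)ᶜ ∧
      IdealSheafData.IsPermissible (vanishingIdeal Z) ∧
        IsPermissibleBlowup (blowup.π (vanishingIdeal Z)) ∧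
          IsIntegral (blowup (vanishingIdeal Z)) ∧ IsProper (blowup.π (vanishingIdeal Z)) ∧
            IsBirational (blowup.π (vanishingIdeal Z)) ∧
              IsIso (blowup.π (vanishingIdeal Z) ∣_
                ⟨Scheme.regularLocus S.X, isOpen_regularLocus_of_locallyOfFiniteType_field S.hom⟩) := by
  haveI := S.isNoetherian_X
  have h1 := hsMaxLocus_of_normal_surface' S.hom S.normal S.dim_eq.le (N := 3) (by norm_num) hX
  exact ⟨hZ ▸ h1.1, hZ ▸ h1.2.1, hZ ▸ h1.2.2.1,
    firstBlowup_of_normal_surface' S.hom S.normal S.dim_eq.le (N := 3) (by norm_num) hX hZ⟩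

end NormalSurface

end Literature.AlgebraicGeometry.Resolution

end
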